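import Mathlib

/-!
# `OrbitDimensionBound` (stmt-ValiantsHypothesis-16133), rung line `filtered_covering` — stub `stub_jordanHolder`,
# part 1: two flags admit a common adapted basis

First helper file for the registered OPEN stub `stub_jordanHolder` (Jordan–Hölder transport of the polystable model
along a common one-parameter degeneration) of `Cruxes/OrbitDimensionBound/Lines/filtered_covering.lean` (route
`FreeSubtorus`, dormant rung `Depth.FilteredShadow`; stub 1 is closed by `…StubPolystableModel.lean`).  Route of this
series: LOCAL CONFLUENCE of one-parameter degenerations (no Jordan–Hölder theory, no quotients, no determinant
hypothesis) — two degenerations of the same matrix admit a common degeneration because the two row flags admit a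
common adapted basis and so do the two column flags.  This file supplies that linear algebra:
* `exists_common_adapted_family` — two antitone chains of subspaces of a finite-dimensional space admit a common
  adapted basis (induction on the dimension: peel the last nonzero piece `U` of one chain, recurse on `U` with the
  traces and on `V ⧸ U` with the images, lift inside `F (wF i) ⊓ G (wG i)` — possible as `U ≤ F (wF i)` — and glue by
  the modular law, `adapted_of_parts`);
* `exists_common_gauge` — matrix form: for invertible `T₁, T₂` with column weights `c₁, c₂` there is an invertible `T`
  with weights `γ₁, γ₂` such that `T₁⁻¹ T` is block-lower-triangular for `(c₁, γ₁)`, `T⁻¹ T₁` for `(γ₁, c₁)`, the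
  level counts of `γ₁`, `c₁` agree, and likewise for the index `2`.
Helper mode (`--supports stmt-ValiantsHypothesis-16133 --as helper`).  Honest framing: [folklore] linear algebra (the
vector-space case of Schreier–Zassenhaus); nothing here bears on `OrbitDimensionBound`, `FreeSubtorus` or VP ≠ VNP (OPEN).
-/


set_option linter.dupNamespace false

namespace Summit.ValiantsHypothesis.ValiantsHypothesis.Theorems.FreeSubtorusOrbitDimensionBound.JordanHolder

open Module Matrix

universe u

section CAB
variable {K : Type*} [Field K]

/-- The span of the image of a predicate-cut of a `Sum.elim` family splits as the join of the two parts. [folklore] -/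
theorem span_image_sumElim {V : Type*} [AddCommGroup V] [Module K V] {ι₁ ι₂ : Type*} (f : ι₁ → V) (g : ι₂ → V)
    (p : ι₁ ⊕ ι₂ → Prop) :
    Submodule.span K (Sum.elim f g '' {i | p i}) =
      Submodule.span K (f '' {i | p (Sum.inl i)}) ⊔ Submodule.span K (g '' {i | p (Sum.inr i)}) := by
  rw [← Submodule.span_union]
  congr 1
  ext x
  simp only [Set.mem_image, Set.mem_setOf_eq, Set.mem_union]
  constructor
  · rintro ⟨i, hi, rfl⟩
    cases i with
    | inl i => exact Or.inl ⟨i, hi, rfl⟩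
    | inr i => exact Or.inr ⟨i, hi, rfl⟩
  · rintro (⟨i, hi, rfl⟩ | ⟨i, hi, rfl⟩)
    · exact ⟨Sum.inl i, hi, rfl⟩
    · exact ⟨Sum.inr i, hi, rfl⟩

/-- **Gluing.**  If a family `vU` in a subspace `U` is adapted to the traces `H l ⊓ U` of an antitone chain `H`, a family
`lift` is adapted to the images `H l + U` modulo `U`, and each `lift i` lies in its own piece `H (w₂ i)`, then the
combined family is adapted to `H` (modular law). [folklore] -/
theorem adapted_of_parts {V : Type*} [AddCommGroup V] [Module K V] (U : Submodule K V)
    {ι₁ ι₂ : Type*} (vU : ι₁ → U) (lift : ι₂ → V) (w₁ : ι₁ → ℕ) (w₂ : ι₂ → ℕ)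
    (H : ℕ → Submodule K V) (hanti : Antitone H)
    (hU : ∀ l, (H l).comap U.subtype = Submodule.span K (vU '' {i | l ≤ w₁ i}))
    (hQ : ∀ l, (H l).map U.mkQ = Submodule.span K ((U.mkQ ∘ lift) '' {i | l ≤ w₂ i}))
    (hlift : ∀ i, lift i ∈ H (w₂ i)) (l : ℕ) :
    H l = Submodule.span K (Sum.elim (fun i => (vU i : V)) lift '' {i | l ≤ Sum.elim w₁ w₂ i}) := by
  rw [span_image_sumElim]
  simp only [Sum.elim_inl, Sum.elim_inr]
  have h1 : Submodule.span K ((fun i => (vU i : V)) '' {i | l ≤ w₁ i}) = H l ⊓ U := by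
    have : (fun i => (vU i : V)) = U.subtype ∘ vU := rfl
    rw [this, Set.image_comp, Submodule.span_image, ← hU, Submodule.map_comap_subtype, inf_comm]
  set L := Submodule.span K (lift '' {i | l ≤ w₂ i}) with hL
  have hLle : L ≤ H l := by
    rw [hL, Submodule.span_le]
    rintro _ ⟨i, hi, rfl⟩
    exact hanti hi (hlift i)
  have h2 : U ⊔ L = U ⊔ H l := by
    rw [← Submodule.comap_map_mkQ, ← Submodule.comap_map_mkQ U (H l), hQ l, hL, Submodule.map_span,
      Set.image_comp]
  rw [h1]
  calc H l = H l ⊓ (U ⊔ H l) := (inf_eq_left.mpr le_sup_right).symm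
    _ = H l ⊓ (U ⊔ L) := by rw [h2]
    _ = (H l ⊓ U) ⊔ L := (inf_sup_assoc_of_le U hLle).symm

/-- The last nonzero piece of an antitone, eventually-zero chain with a proper nontrivial piece. [folklore] -/
theorem exists_last_piece {V : Type*} [AddCommGroup V] [Module K V] (F : ℕ → Submodule K V) (hF : Antitone F)
    (hN : ∃ N, F N = ⊥) (h : ∃ l, F l ≠ ⊥ ∧ F l ≠ ⊤) :
    ∃ K₀, F (K₀ + 1) = ⊥ ∧ F K₀ ≠ ⊥ ∧ F K₀ ≠ ⊤ := by
  classical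
  obtain ⟨N, hN⟩ := hN
  obtain ⟨l, hl1, hl2⟩ := h
  have hlN : l ≤ N := by
    by_contra hc
    push Not at hc
    exact hl1 (eq_bot_iff.mpr (hN ▸ hF hc.le))
  refine ⟨Nat.findGreatest (fun k => F k ≠ ⊥) N, ?_, Nat.findGreatest_spec (P := fun k => F k ≠ ⊥) hlN hl1, ?_⟩
  · by_cases hk : Nat.findGreatest (fun k => F k ≠ ⊥) N + 1 ≤ N
    · have := Nat.findGreatest_is_greatest (lt_add_one _) hk
      simpa using this
    · push Not at hk
      have := hF hk.le
      rw [hN] at this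
      exact le_bot_iff.mp this
  · intro htop
    have hle : l ≤ Nat.findGreatest (fun k => F k ≠ ⊥) N := Nat.le_findGreatest (P := fun k => F k ≠ ⊥) hlN hl1
    have : ⊤ ≤ F l := htop ▸ hF hle
    exact hl2 (top_le_iff.mp this)

/-- A chain all of whose pieces are `⊥` or `⊤` is adapted to ANY spanning family, with a constant weight. [folklore] -/
theorem adapted_of_dichotomy {V : Type*} [AddCommGroup V] [Module K V] {ι : Type*} (v : ι → V)
    (hv : Submodule.span K (Set.range v) = ⊤) (F : ℕ → Submodule K V) (hF : Antitone F) (hF0 : F 0 = ⊤)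
    (hN : ∃ N, F N = ⊥) (hd : ∀ l, F l ≠ ⊥ → F l = ⊤) :
    ∃ KF : ℕ, ∀ l, F l = Submodule.span K (v '' {_i : ι | l ≤ KF}) := by
  classical
  obtain ⟨N, hN⟩ := hN
  refine ⟨Nat.findGreatest (fun k => F k = ⊤) N, fun l => ?_⟩
  by_cases hl : l ≤ Nat.findGreatest (fun k => F k = ⊤) N
  · have htop : F (Nat.findGreatest (fun k => F k = ⊤) N) = ⊤ := Nat.findGreatest_spec (P := fun k => F k = ⊤) (Nat.zero_le N) hF0
    have hset : {_i : ι | l ≤ Nat.findGreatest (fun k => F k = ⊤) N} = Set.univ := Set.eq_univ_of_forall fun _ => hl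
    rw [hset, Set.image_univ, hv]
    exact top_le_iff.mp (htop ▸ hF hl)
  · have hset : {_i : ι | l ≤ Nat.findGreatest (fun k => F k = ⊤) N} = ∅ := Set.eq_empty_of_forall_notMem fun _ h => hl h
    rw [hset, Set.image_empty, Submodule.span_empty]
    push Not at hl
    by_cases hlN : l ≤ N
    · have hnt : ¬ F l = ⊤ := Nat.findGreatest_is_greatest (P := fun k => F k = ⊤) hl hlN
      by_contra hb
      exact hnt (hd l hb)
    · push Not at hlN
      exact eq_bot_iff.mpr (hN ▸ hF hlN.le)

/-- **Induction step** of the common-adapted-basis theorem: peel the last nonzero piece `U = F K₀` of the first chain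
(IH on `U` with the traces, IH on `V ⧸ U` with the images; lifts of the quotient family chosen inside
`F (w i) ⊓ G (w' i)`, which is possible because `U ≤ F (w i)`). [folklore] -/
theorem cab_step {V : Type u} [AddCommGroup V] [Module K V] [FiniteDimensional K V]
    (IH : ∀ (W : Type u) [AddCommGroup W] [Module K W] [FiniteDimensional K W],
      finrank K W < finrank K V → ∀ (F G : ℕ → Submodule K W), Antitone F → Antitone G → F 0 = ⊤ → G 0 = ⊤ →
        (∃ N, F N = ⊥) → (∃ N, G N = ⊥) →
        ∃ (ι : Type) (_ : Fintype ι) (v : ι → W) (wF wG : ι → ℕ), LinearIndependent K v ∧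
          (∀ l, F l = Submodule.span K (v '' {i | l ≤ wF i})) ∧ (∀ l, G l = Submodule.span K (v '' {i | l ≤ wG i})))
    (F G : ℕ → Submodule K V) (hF : Antitone F) (hG : Antitone G) (hF0 : F 0 = ⊤) (hG0 : G 0 = ⊤)
    (hFN : ∃ N, F N = ⊥) (hGN : ∃ N, G N = ⊥) (K₀ : ℕ) (hK₁ : F (K₀ + 1) = ⊥) (hbot : F K₀ ≠ ⊥) (htop : F K₀ ≠ ⊤) :
    ∃ (ι : Type) (_ : Fintype ι) (v : ι → V) (wF wG : ι → ℕ), LinearIndependent K v ∧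
      (∀ l, F l = Submodule.span K (v '' {i | l ≤ wF i})) ∧ (∀ l, G l = Submodule.span K (v '' {i | l ≤ wG i})) := by
  classical
  set U := F K₀ with hUdef
  have hUlt : finrank K U < finrank K V := Submodule.finrank_lt htop
  have hQlt : finrank K (V ⧸ U) < finrank K V := by
    have h := Submodule.finrank_quotient_add_finrank U
    have hpos : 0 < finrank K U := by
      rw [pos_iff_ne_zero, Ne, Submodule.finrank_eq_zero]
      exact hbot
    omega
  -- the traces on `U`
  obtain ⟨ι₁, _, vU, wFU, wGU, hli₁, hFU, hGU⟩ := IH U hUlt (fun l => (F l).comap U.subtype)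
    (fun l => (G l).comap U.subtype) (fun a b hab => Submodule.comap_mono (hF hab))
    (fun a b hab => Submodule.comap_mono (hG hab)) (by simp [hF0]) (by simp [hG0])
    (by obtain ⟨N, hN⟩ := hFN; exact ⟨N, by rw [hN, Submodule.comap_bot, Submodule.ker_subtype]⟩)
    (by obtain ⟨N, hN⟩ := hGN; exact ⟨N, by rw [hN, Submodule.comap_bot, Submodule.ker_subtype]⟩)
  -- the images modulo `U`
  obtain ⟨ι₂, _, vQ, wFQ, wGQ, hli₂, hFQ, hGQ⟩ := IH (V ⧸ U) hQlt (fun l => (F l).map U.mkQ)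
    (fun l => (G l).map U.mkQ) (fun a b hab => Submodule.map_mono (hF hab))
    (fun a b hab => Submodule.map_mono (hG hab)) (by simp [hF0, Submodule.map_top, Submodule.range_mkQ])
    (by simp [hG0, Submodule.map_top, Submodule.range_mkQ])
    (by obtain ⟨N, hN⟩ := hFN; exact ⟨N, by rw [hN, Submodule.map_bot]⟩)
    (by obtain ⟨N, hN⟩ := hGN; exact ⟨N, by rw [hN, Submodule.map_bot]⟩)
  -- quotient weights for `F` do not exceed `K₀`
  have hwle : ∀ i, wFQ i ≤ K₀ := by
    intro i
    by_contra hc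
    push Not at hc
    have hmem : vQ i ∈ (F (wFQ i)).map U.mkQ := by
      rw [hFQ]; exact Submodule.subset_span ⟨i, by simp, rfl⟩
    have hzero : (F (wFQ i)).map U.mkQ = ⊥ := by
      have : F (wFQ i) = ⊥ := eq_bot_iff.mpr (hK₁ ▸ hF (Nat.succ_le_of_lt hc))
      rw [this, Submodule.map_bot]
    rw [hzero, Submodule.mem_bot] at hmem
    exact hli₂.ne_zero i hmem
  -- lifts inside `F (wFQ i) ⊓ G (wGQ i)`
  have hlift : ∀ i, ∃ y, y ∈ F (wFQ i) ∧ y ∈ G (wGQ i) ∧ U.mkQ y = vQ i := by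
    intro i
    have hG' : vQ i ∈ (G (wGQ i)).map U.mkQ := by
      rw [hGQ]; exact Submodule.subset_span ⟨i, by simp, rfl⟩
    obtain ⟨y, hy, hyq⟩ := Submodule.mem_map.mp hG'
    refine ⟨y, ?_, hy, hyq⟩
    have hF' : vQ i ∈ (F (wFQ i)).map U.mkQ := by
      rw [hFQ]; exact Submodule.subset_span ⟨i, by simp, rfl⟩
    have hy' : y ∈ ((F (wFQ i)).map U.mkQ).comap U.mkQ := by
      rw [Submodule.mem_comap, hyq]; exact hF'
    rw [Submodule.comap_map_mkQ, sup_eq_right.mpr (hF (hwle i) : U ≤ F (wFQ i))] at hy'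
    exact hy'
  choose lift hliftF hliftG hliftq using hlift
  have hcomp : (U.mkQ ∘ lift : ι₂ → V ⧸ U) = vQ := funext hliftq
  refine ⟨ι₁ ⊕ ι₂, inferInstance, Sum.elim (fun i => (vU i : V)) lift, Sum.elim wFU wFQ, Sum.elim wGU wGQ,
    ?_, ?_, ?_⟩
  · -- linear independence of the glued family
    refine LinearIndependent.sum_type (hli₁.map' U.subtype (Submodule.ker_subtype U)) ?_ ?_
    · refine LinearIndependent.of_comp U.mkQ ?_
      rw [hcomp]; exact hli₂
    · rw [Submodule.disjoint_def]
      intro x hx₁ hx₂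
      have hxU : x ∈ U := by
        refine (Submodule.span_le.mpr ?_) hx₁
        rintro _ ⟨i, rfl⟩
        exact (vU i).2
      obtain ⟨c, rfl⟩ := (Submodule.mem_span_range_iff_exists_fun K).mp hx₂
      have h0 : U.mkQ (∑ i, c i • lift i) = 0 := by
        rw [Submodule.mkQ_apply, Submodule.Quotient.mk_eq_zero]; exact hxU
      simp only [map_sum, map_smul, hliftq] at h0
      have hc := Fintype.linearIndependent_iff.mp hli₂ c h0
      simp [hc]
  · intro l
    exact adapted_of_parts U vU lift wFU wFQ F hF hFU (fun l => by rw [hcomp]; exact hFQ l) hliftF l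
  · intro l
    exact adapted_of_parts U vU lift wGU wGQ G hG hGU (fun l => by rw [hcomp]; exact hGQ l) hliftG l

/-- **Two flags admit a common adapted basis.**  For two antitone chains `F, G` of subspaces of a finite-dimensional
vector space (starting at `⊤`, eventually `⊥`) there is a linearly independent spanning family `v` and weights `wF, wG`
with `F l = span {v i | l ≤ wF i}` and `G l = span {v i | l ≤ wG i}` for every `l` (Schreier–Zassenhaus for vector
spaces / the linear algebra behind the Bruhat decomposition). [folklore] -/
theorem exists_common_adapted_family (d : ℕ) :
    ∀ (V : Type u) [AddCommGroup V] [Module K V] [FiniteDimensional K V], finrank K V = d →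
      ∀ (F G : ℕ → Submodule K V), Antitone F → Antitone G → F 0 = ⊤ → G 0 = ⊤ →
        (∃ N, F N = ⊥) → (∃ N, G N = ⊥) →
        ∃ (ι : Type) (_ : Fintype ι) (v : ι → V) (wF wG : ι → ℕ), LinearIndependent K v ∧
          (∀ l, F l = Submodule.span K (v '' {i | l ≤ wF i})) ∧
          (∀ l, G l = Submodule.span K (v '' {i | l ≤ wG i})) := by
  induction d using Nat.strong_induction_on with
  | _ d ih =>
  intro V _ _ _ hd F G hF hG hF0 hG0 hFN hGN
  have IH : ∀ (W : Type u) [AddCommGroup W] [Module K W] [FiniteDimensional K W],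
      finrank K W < finrank K V → ∀ (F G : ℕ → Submodule K W), Antitone F → Antitone G → F 0 = ⊤ → G 0 = ⊤ →
        (∃ N, F N = ⊥) → (∃ N, G N = ⊥) →
        ∃ (ι : Type) (_ : Fintype ι) (v : ι → W) (wF wG : ι → ℕ), LinearIndependent K v ∧
          (∀ l, F l = Submodule.span K (v '' {i | l ≤ wF i})) ∧
          (∀ l, G l = Submodule.span K (v '' {i | l ≤ wG i})) :=
    fun W _ _ _ hW => ih (finrank K W) (hd ▸ hW) W rfl
  by_cases hFp : ∃ l, F l ≠ ⊥ ∧ F l ≠ ⊤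
  · obtain ⟨K₀, h1, h2, h3⟩ := exists_last_piece F hF hFN hFp
    exact cab_step IH F G hF hG hF0 hG0 hFN hGN K₀ h1 h2 h3
  by_cases hGp : ∃ l, G l ≠ ⊥ ∧ G l ≠ ⊤
  · obtain ⟨K₀, h1, h2, h3⟩ := exists_last_piece G hG hGN hGp
    obtain ⟨ι, _, v, wG, wF, hli, hG', hF'⟩ := cab_step IH G F hG hF hG0 hF0 hGN hFN K₀ h1 h2 h3
    exact ⟨ι, inferInstance, v, wF, wG, hli, hF', hG'⟩
  -- degenerate case: both chains take only the values `⊥`, `⊤`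
  push Not at hFp hGp
  let b := Module.finBasis K V
  have hb : Submodule.span K (Set.range b) = ⊤ := b.span_eq
  obtain ⟨KF, hKF⟩ := adapted_of_dichotomy b hb F hF hF0 hFN hFp
  obtain ⟨KG, hKG⟩ := adapted_of_dichotomy b hb G hG hG0 hGN hGp
  exact ⟨Fin (finrank K V), inferInstance, b, fun _ => KF, fun _ => KG, b.linearIndependent, hKF, hKG⟩

end CAB

/-! ### §2 Matrix form: a common gauge for two weighted gauges -/
section GLForm

variable {K : Type*} [Field K] {m : ℕ}

/-- Members of the span of standard basis vectors indexed by `J` vanish off `J`. [folklore] -/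
theorem apply_eq_zero_of_mem_span_single (J : Set (Fin m)) {x : Fin m → K}
    (hx : x ∈ Submodule.span K ((fun j => Pi.single j (1 : K)) '' J)) (j : Fin m) (hj : j ∉ J) : x j = 0 := by
  induction hx using Submodule.span_induction with
  | mem y hy =>
    obtain ⟨j', hj', rfl⟩ := hy
    have hne : j ≠ j' := fun h => hj (h ▸ hj')
    simp [Pi.single_eq_of_ne hne]
  | zero => simp
  | add y z _ _ hy hz => simp [hy, hz]
  | smul c y _ hy => simp [hy]

/-- Columns of `T₁⁻¹ T` computed as `T₁⁻¹` applied to the columns of `T`. [folklore] -/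
theorem inv_mul_apply_eq_mulVec_col (T₁ T : GL (Fin m) K) (i j : Fin m) :
    ((T₁⁻¹ * T : GL (Fin m) K) : Matrix (Fin m) (Fin m) K) i j =
      (((T₁⁻¹ : GL (Fin m) K) : Matrix (Fin m) (Fin m) K) *ᵥ ((T : Matrix (Fin m) (Fin m) K).col j)) i := by
  rw [Units.val_mul, Matrix.mul_apply, Matrix.mulVec, dotProduct]
  rfl

/-- `T⁻¹` sends the `j`-th column of `T` to the `j`-th standard basis vector. [folklore] -/
theorem inv_mulVec_col (T : GL (Fin m) K) (j : Fin m) :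
    (((T⁻¹ : GL (Fin m) K) : Matrix (Fin m) (Fin m) K) *ᵥ ((T : Matrix (Fin m) (Fin m) K).col j)) =
      Pi.single j (1 : K) := by
  rw [← Matrix.mulVec_single_one, Matrix.mulVec_mulVec, ← Units.val_mul, inv_mul_cancel, Units.val_one,
    Matrix.one_mulVec]

/-- **Flag inclusion ⇒ block-lower-triangularity.**  If the weighted column flag of `T` (weights `γ`) lies piece by piece
inside the weighted column flag of `T₁` (weights `c`), then `T₁⁻¹ T` has zero `(i, j)` entry whenever `c i < γ j`.
[folklore] -/
theorem lowerTri_of_flag_le (T₁ T : GL (Fin m) K) (c γ : Fin m → ℕ)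
    (hle : ∀ l, Submodule.span K (((T : Matrix (Fin m) (Fin m) K).col) '' {j | l ≤ γ j}) ≤
      Submodule.span K (((T₁ : Matrix (Fin m) (Fin m) K).col) '' {j | l ≤ c j})) (i j : Fin m) (hij : c i < γ j) :
    ((T₁⁻¹ * T : GL (Fin m) K) : Matrix (Fin m) (Fin m) K) i j = 0 := by
  rw [inv_mul_apply_eq_mulVec_col]
  have hcol : (T : Matrix (Fin m) (Fin m) K).col j ∈
      Submodule.span K (((T₁ : Matrix (Fin m) (Fin m) K).col) '' {j' | γ j ≤ c j'}) :=
    hle (γ j) (Submodule.subset_span ⟨j, by simp, rfl⟩)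
  have hmap : (Matrix.toLin' ((T₁⁻¹ : GL (Fin m) K) : Matrix (Fin m) (Fin m) K))
      ((T : Matrix (Fin m) (Fin m) K).col j) ∈
      Submodule.span K ((fun j' => Pi.single j' (1 : K)) '' {j' | γ j ≤ c j'}) := by
    have h1 := Submodule.mem_map_of_mem (f := Matrix.toLin' ((T₁⁻¹ : GL (Fin m) K) : Matrix (Fin m) (Fin m) K)) hcol
    rw [Submodule.map_span, ← Set.image_comp] at h1
    have hfun : (⇑(Matrix.toLin' ((T₁⁻¹ : GL (Fin m) K) : Matrix (Fin m) (Fin m) K)) ∘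
        ((T₁ : Matrix (Fin m) (Fin m) K).col)) = fun j' => Pi.single j' (1 : K) :=
      funext fun j' => by simp only [Function.comp_apply, Matrix.toLin'_apply, inv_mulVec_col]
    rwa [hfun] at h1
  rw [Matrix.toLin'_apply] at hmap
  exact apply_eq_zero_of_mem_span_single _ hmap i (by simpa using hij)

/-- The span of a set of columns of an invertible matrix has dimension the number of columns. [folklore] -/
theorem finrank_span_cols (T : GL (Fin m) K) (p : Fin m → Prop) [DecidablePred p] :
    Module.finrank K (Submodule.span K (((T : Matrix (Fin m) (Fin m) K).col) '' {j | p j})) =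
      (Finset.univ.filter p).card := by
  have hli : LinearIndependent K (T : Matrix (Fin m) (Fin m) K).col :=
    Matrix.linearIndependent_cols_iff_isUnit.mpr (Units.isUnit T)
  have hli' : LinearIndependent K (fun j : {j // p j} => (T : Matrix (Fin m) (Fin m) K).col j) :=
    hli.comp _ Subtype.val_injective
  have hrange : Set.range (fun j : {j // p j} => (T : Matrix (Fin m) (Fin m) K).col j) =
      ((T : Matrix (Fin m) (Fin m) K).col) '' {j | p j} := by
    ext x; simp
  rw [← hrange, finrank_span_eq_card hli', Fintype.card_subtype]

/-- The three consequences of a flag EQUALITY between the weighted column flags of `T₁` (weights `c`) and `T`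
(weights `γ`): `T₁⁻¹ T` is block-lower-triangular for `(c, γ)`, `T⁻¹ T₁` for `(γ, c)`, and the level counts agree.
[folklore] -/
theorem flag_eq_consequences (T₁ T : GL (Fin m) K) (c γ : Fin m → ℕ)
    (heq : ∀ l, Submodule.span K (((T₁ : Matrix (Fin m) (Fin m) K).col) '' {j | l ≤ c j}) =
      Submodule.span K (((T : Matrix (Fin m) (Fin m) K).col) '' {j | l ≤ γ j})) :
    (∀ i j, c i < γ j → ((T₁⁻¹ * T : GL (Fin m) K) : Matrix (Fin m) (Fin m) K) i j = 0) ∧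
    (∀ i j, γ i < c j → ((T⁻¹ * T₁ : GL (Fin m) K) : Matrix (Fin m) (Fin m) K) i j = 0) ∧
    (∀ k, (Finset.univ.filter fun j => k ≤ γ j).card = (Finset.univ.filter fun j => k ≤ c j).card) := by
  refine ⟨fun i j hij => lowerTri_of_flag_le T₁ T c γ (fun l => (heq l).ge) i j hij,
    fun i j hij => lowerTri_of_flag_le T T₁ γ c (fun l => (heq l).le) i j hij, fun k => ?_⟩
  rw [← finrank_span_cols T (fun j => k ≤ γ j), ← finrank_span_cols T₁ (fun j => k ≤ c j)]
  exact congrArg (fun S : Submodule K (Fin m → K) => Module.finrank K S) (heq k).symm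

/-- **Common gauge for two weighted gauges (two flags admit a common adapted basis — matrix form).**  Given invertible
`T₁, T₂` with column weights `c₁, c₂`, there is an invertible `T` with column weights `γ₁, γ₂` whose weighted column
flags are those of `(T₁, c₁)` and of `(T₂, c₂)` simultaneously; consequently `T₁⁻¹ T` is block-lower-triangular for
`(c₁, γ₁)`, `T⁻¹ T₁` for `(γ₁, c₁)`, the level counts of `γ₁` and `c₁` agree, and likewise for the index `2`.
[folklore] -/
theorem exists_common_gauge (T₁ T₂ : GL (Fin m) K) (c₁ c₂ : Fin m → ℕ) :
    ∃ (T : GL (Fin m) K) (γ₁ γ₂ : Fin m → ℕ),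
      ((∀ i j, c₁ i < γ₁ j → ((T₁⁻¹ * T : GL (Fin m) K) : Matrix (Fin m) (Fin m) K) i j = 0) ∧
        (∀ i j, γ₁ i < c₁ j → ((T⁻¹ * T₁ : GL (Fin m) K) : Matrix (Fin m) (Fin m) K) i j = 0) ∧
        (∀ k, (Finset.univ.filter fun j => k ≤ γ₁ j).card = (Finset.univ.filter fun j => k ≤ c₁ j).card)) ∧
      ((∀ i j, c₂ i < γ₂ j → ((T₂⁻¹ * T : GL (Fin m) K) : Matrix (Fin m) (Fin m) K) i j = 0) ∧
        (∀ i j, γ₂ i < c₂ j → ((T⁻¹ * T₂ : GL (Fin m) K) : Matrix (Fin m) (Fin m) K) i j = 0) ∧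
        (∀ k, (Finset.univ.filter fun j => k ≤ γ₂ j).card = (Finset.univ.filter fun j => k ≤ c₂ j).card)) := by
  classical
  -- the two weighted column flags
  have flag_hyps : ∀ (S : GL (Fin m) K) (c : Fin m → ℕ),
      Antitone (fun l => Submodule.span K (((S : Matrix (Fin m) (Fin m) K).col) '' {j | l ≤ c j})) ∧
      Submodule.span K (((S : Matrix (Fin m) (Fin m) K).col) '' {j | 0 ≤ c j}) = ⊤ ∧
      ∃ N, Submodule.span K (((S : Matrix (Fin m) (Fin m) K).col) '' {j | N ≤ c j}) = ⊥ := by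
    intro S c
    refine ⟨fun l l' hll' => Submodule.span_mono (Set.image_mono fun j (hj : l' ≤ c j) => hll'.trans hj), ?_,
      ⟨Finset.univ.sup c + 1, ?_⟩⟩
    · have hli : LinearIndependent K (S : Matrix (Fin m) (Fin m) K).col :=
        Matrix.linearIndependent_cols_iff_isUnit.mpr (Units.isUnit S)
      have huniv : {j : Fin m | 0 ≤ c j} = Set.univ := Set.eq_univ_of_forall fun _ => Nat.zero_le _
      rw [huniv, Set.image_univ]
      exact hli.span_eq_top_of_card_eq_finrank' (by simp)
    · have hempty : {j : Fin m | Finset.univ.sup c + 1 ≤ c j} = ∅ := by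
        refine Set.eq_empty_of_forall_notMem fun j (hj : Finset.univ.sup c + 1 ≤ c j) => ?_
        have : c j ≤ Finset.univ.sup c := Finset.le_sup (Finset.mem_univ j)
        omega
      rw [hempty, Set.image_empty, Submodule.span_empty]
  obtain ⟨hF, hF0, hFN⟩ := flag_hyps T₁ c₁
  obtain ⟨hG, hG0, hGN⟩ := flag_hyps T₂ c₂
  obtain ⟨ι, _, v, wF, wG, hli, hFv, hGv⟩ := exists_common_adapted_family (K := K) (finrank K (Fin m → K))
    (Fin m → K) rfl _ _ hF hG hF0 hG0 hFN hGN
  -- the common adapted family is a basis; reindex it by `Fin m` and read it as an invertible matrix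
  have hspan : ⊤ ≤ Submodule.span K (Set.range v) := by
    have h0 := hFv 0
    have huniv : {i : ι | 0 ≤ wF i} = Set.univ := Set.eq_univ_of_forall fun _ => Nat.zero_le _
    rw [huniv, Set.image_univ, hF0] at h0
    exact h0.le
  have hcard : Fintype.card ι = m := by
    have := Module.finrank_eq_card_basis (Module.Basis.mk hli hspan)
    simpa using this.symm
  let e : ι ≃ Fin m := Fintype.equivFinOfCardEq hcard
  let Tm : Matrix (Fin m) (Fin m) K := Matrix.of fun i j => v (e.symm j) i
  have hcol : ∀ j, Tm.col j = v (e.symm j) := fun j => rfl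
  have hTli : LinearIndependent K Tm.col := by
    have : Tm.col = v ∘ e.symm := funext hcol
    rw [this]; exact hli.comp _ e.symm.injective
  have hunit : IsUnit Tm := Matrix.linearIndependent_cols_iff_isUnit.mp hTli
  have himage : ∀ (w : ι → ℕ) (l : ℕ), (Tm.col) '' {j | l ≤ w (e.symm j)} = v '' {i | l ≤ w i} := by
    intro w l
    ext x
    simp only [Set.mem_image, Set.mem_setOf_eq, hcol]
    constructor
    · rintro ⟨j, hj, rfl⟩; exact ⟨e.symm j, hj, rfl⟩
    · rintro ⟨i, hi, rfl⟩; exact ⟨e i, by simpa using hi, by simp⟩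
  refine ⟨hunit.unit, fun j => wF (e.symm j), fun j => wG (e.symm j),
    flag_eq_consequences T₁ hunit.unit c₁ _ fun l => ?_, flag_eq_consequences T₂ hunit.unit c₂ _ fun l => ?_⟩
  · rw [hunit.unit_spec, himage, ← hFv]
  · rw [hunit.unit_spec, himage, ← hGv]

end GLForm
end Summit.ValiantsHypothesis.ValiantsHypothesis.Theorems.FreeSubtorusOrbitDimensionBound.JordanHolder
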